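import Summits.QuantumFields.BalabanUV.T4Continuum.Support.NE7PinnedLandauNewtonSchemeT
import Summits.QuantumFields.BalabanUV.T4Continuum.Support.NE7PointedLandauRep
import HarnessLib

/-!
# NE7PinnedLandauRepT — THE PINNED LANDAU REPRESENTATIVE RELATIVE TO `W`, TEST CLASS `T`, MODULO THE THREE LINEAR LETTERS (hProj, hG, hR): `∃ u, Z` with `U^u = We^{Z}`,
# `u(M•z) = 1` (THE TOP IS KEPT), `Z` skew periodic and Landau AGAINST `T`, `‖Z‖ ≤ 2r̄`, `‖u − 1‖ ≤ 4c₀M²c_Rb₀` — F82 `NE7PointedLandauRep.exists_pointedLandauRep_W_of_supFacts` with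
# the test quantifier abstracted; step (c) of «REP WITH A FIXED TOP (PG-dual)», file 23

Cell `pub-balaban`, rung (B)+1 sub-cell t4, lineage `b2b-balaban-t4-ne7-p1` (CRUX PROVER NE7 #1 = OWNER of row NE7), generation 77; memo
`t4/b2b-balaban-t4-ne7-p1-g77/GAUGED-TOP-TT.md` §4–§5.  File F89 — F82 over F88 `NE7PinnedLandauNewtonSchemeT.exists_newton_sequence_W_T` (limit `i → ∞`: pointwise limits,
`isClosed_unitary`, `log` 4∕3-Lipschitz, pairing `O(2^{−i})`, corners stay pinned).
WHY (memo §3–§5).  With `T ν :=` «vanishing means on the corner-centred blocks `M•z + [−⌊M∕2⌋, M − ⌊M∕2⌋)^d`» this is the SPEC of «REP WITH A FIXED TOP (PG-dual)» as a theorem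
MODULO its three linear letters: hProj (the Petrov–Galerkin projection exists), hG ((H0_W) on pointed generators — F83 in the class), hR (the PG sup letter, `c_R` M-free —
flat numerics j276100 support it; NOT proved).  Consumers: F76∕F78 (fibre-preserving, `ω = 0`; `NE7TopMismatchLetters.cavgIter_gaugeAct_eq_of_pinned`), with (L1)'s Landau
quantifier read against `T`.
WHAT ([folklore]; 0 def, 0 sorry).  **`exists_pinnedLandauRep_W_T_of_supFacts`** — F82's statement with `T`.
HONEST FRAMING (page 1): a generalisation of a tree file on OUR objects (test class abstracted); the letters hG ∕ hR ∕ hProj are HYPOTHESES; nothing of Bałaban's asserted; (APE) NOT proved; NOT ONE-STEP, NOT NE7; spine 0∕9; finite T⁴ rung (B)+1 — NOT infinite volume, NOT mass gap, NOT `BetaPertH`, NOT Clay.  Continuum YM on T⁴ ⇐ BetaPertH ∧ nine spine estimates (0/9 proved); BetaPertH ⇐ (D1) ∧ (D4) ∧ CAP+tail; G-an2-4 gates asym, D1 and NE2/3/4.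
-/

set_option autoImplicit false

open NormedSpace Filter Topology
open scoped BigOperators Matrix.Norms.L2Operator
open Finset

namespace Summit.QuantumFields.BalabanUV.T4Continuum.NE7PinnedLandauRepT

open Literature.MathematicalPhysics.QuantumFieldTheory.Balaban1983to89
open B7Prop1Explicit B7Prop2Explicit MatrixLog
open T4AveragingDeficitWall (Ad IsUnitaryCfg IsSkewDir vary)
open T4AveragingDeficitWallBoundary (IsPeriodicCfg periodBox)
open AveragingDeficitPeriodicCounting (IsPeriodicDir)
open AveragingDeficitMultiLevelPrep (LevelSmall)
open T4AveragingDeficitWall (SmallField)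
open NE3EnergyShapes (IsUnitarySite IsPeriodicSite)
open NE3CovariantWeitzenbock (covDiv)
open NE3CovariantCalculus (hsR hsR_add_left hsR_sub_left abs_hsR_le)
open BlockAveragePushDirGauge (gaugeDir)
open NE3.PairLandauB8 (covLapSite)
open NE3.LandauProjectionB8 (sum_hsR_gaugeDir_gaugeDir_covLapSite)
open NE7ExpLogSecondOrder (norm_mlog_sub_mlog_le_four_thirds)
open NE3.CurvedLandauNewtonStep (isUnitaryCfg_gaugeAct_W isPeriodicDir_mlog_rel isSkewDir_mlog_rel)
open NE3.CurvedLandauRep (val_inv_eq_star)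
open NE7PinnedLandauNewtonSchemeT (exists_newton_sequence_W_T)

noncomputable section

variable {d : ℕ} {n : Type*} [Fintype n] [DecidableEq n]

/-- **THE PINNED LANDAU REPRESENTATIVE RELATIVE TO `W`, TEST CLASS `T`, MODULO THE THREE LINEAR LETTERS** (statement in the module docstring). [folklore] -/
theorem exists_pinnedLandauRep_W_T_of_supFacts [Nonempty n] (hd : 1 ≤ d) {L N : ℕ} (hL : 2 ≤ L) (hN : 1 ≤ N) (j : ℕ) (T : (Site d → Matrix n n ℂ) → Prop) {c₀ c₁ cR : ℝ}
    (hc₀ : 0 ≤ c₀) (hc₁ : 0 ≤ c₁) (hcR : 1 ≤ cR)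
    {W : Site d → Fin d → (Matrix n n ℂ)ˣ} (hWu : IsUnitaryCfg W) (hWP : IsPeriodicCfg W ((N * L ^ (j + 1) : ℕ) : ℤ))
    (hG : ∀ mu : Site d → Matrix n n ℂ, ((∀ y, mu y ∈ skewAdjoint (Matrix n n ℂ)) ∧ (∀ (y : Site d) (i : Fin d), mu (y + ((N * L ^ (j + 1) : ℕ) : ℤ) • e i) = mu y) ∧
        (∀ w : Site d, mu ((((L ^ (j + 1) : ℕ) : ℤ)) • w) = 0)) → ∀ B : ℝ,
      (∀ y : Site d, ‖covLapSite W mu y‖ ≤ B) →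
        (∀ y : Site d, ‖mu y‖ ≤ c₀ * ((L : ℝ) ^ (j + 1)) ^ 2 * B) ∧
        (∀ (y : Site d) (μ : Fin d), ‖gaugeDir W mu y μ‖ ≤ c₁ * (L : ℝ) ^ (j + 1) * B))
    (hR : ∀ (F : Site d → (Matrix n n ℂ)), (∀ y : Site d, F y ∈ skewAdjoint (Matrix n n ℂ)) →
      (∀ (y : Site d) (i : Fin d), F (y + ((N * L ^ (j + 1) : ℕ) : ℤ) • e i) = F y) →
      ∀ mu : Site d → Matrix n n ℂ, ((∀ y, mu y ∈ skewAdjoint (Matrix n n ℂ)) ∧ (∀ (y : Site d) (i : Fin d), mu (y + ((N * L ^ (j + 1) : ℕ) : ℤ) • e i) = mu y) ∧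
        (∀ w : Site d, mu ((((L ^ (j + 1) : ℕ) : ℤ)) • w) = 0)) →
        (∀ nu : Site d → Matrix n n ℂ, (∀ y, nu y ∈ skewAdjoint (Matrix n n ℂ)) →
          (∀ (y : Site d) (i : Fin d), nu (y + ((N * L ^ (j + 1) : ℕ) : ℤ) • e i) = nu y) → T nu →
          ∑ y ∈ periodBox (d := d) (N * L ^ (j + 1)),
            hsR (F y + covLapSite W mu y) (covLapSite W nu y) = 0) →
        ∀ B : ℝ, (∀ y : Site d, ‖F y‖ ≤ B) → ∀ y : Site d, ‖covLapSite W mu y‖ ≤ cR * B)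
    (hProj : ∀ Y : Site d → Fin d → Matrix n n ℂ, ∃ lam : Site d → Matrix n n ℂ,
      (∀ y, lam y ∈ skewAdjoint (Matrix n n ℂ)) ∧ (∀ (y : Site d) (i : Fin d), lam (y + ((N * L ^ (j + 1) : ℕ) : ℤ) • e i) = lam y) ∧
      (∀ w : Site d, lam ((((L ^ (j + 1) : ℕ) : ℤ)) • w) = 0) ∧
      (∀ nu : Site d → Matrix n n ℂ, (∀ y, nu y ∈ skewAdjoint (Matrix n n ℂ)) →
          (∀ (y : Site d) (i : Fin d), nu (y + ((N * L ^ (j + 1) : ℕ) : ℤ) • e i) = nu y) → T nu →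
        ∑ y ∈ periodBox (d := d) (N * L ^ (j + 1)), ∑ κ : Fin d, hsR (Y y κ + gaugeDir W lam y κ) (gaugeDir W (covLapSite W nu) y κ) = 0))
    {U : Site d → Fin d → (Matrix n n ℂ)ˣ} (hUu : IsUnitaryCfg U) (hUP : IsPeriodicCfg U ((N * L ^ (j + 1) : ℕ) : ℤ))
    {r₀ b₀ : ℝ} (hr₀ : ∀ (y : Site d) (μ : Fin d), ‖(((W y μ)⁻¹ * U y μ : (Matrix n n ℂ)ˣ) : (Matrix n n ℂ)) - 1‖ ≤ r₀)
    (hb₀ : ∀ x : Site d, ‖covDiv W (fun y μ => mlog (((W y μ)⁻¹ * U y μ : (Matrix n n ℂ)ˣ) : (Matrix n n ℂ))) x‖ ≤ b₀)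
    (hreg₁ : c₀ * ((L : ℝ) ^ (j + 1)) ^ 2 * (cR * b₀) ≤ 1 / 10) (hreg₂ : c₁ * (L : ℝ) ^ (j + 1) * (cR * b₀) ≤ 1 / 25)
    (hreg₃ : r₀ + 5 / 2 * (c₁ * (L : ℝ) ^ (j + 1) * (cR * b₀)) ≤ 1 / 20)
    (hline : cR * (4 * (c₀ * ((L : ℝ) ^ (j + 1)) ^ 2) * (b₀ + 4 * (cR * b₀))
        + 25 * d * (r₀ + 5 / 2 * (c₁ * (L : ℝ) ^ (j + 1) * (cR * b₀))) * (c₁ * (L : ℝ) ^ (j + 1))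
        + 14 * d * (c₁ * (L : ℝ) ^ (j + 1)) ^ 2 * (cR * b₀)) ≤ 1 / 2) :
    ∃ (u : Site d → (Matrix n n ℂ)ˣ) (Z : Site d → Fin d → (Matrix n n ℂ)),
      IsUnitarySite u ∧ IsPeriodicSite u ((N * L ^ (j + 1) : ℕ) : ℤ) ∧ IsSkewDir Z ∧ IsPeriodicDir Z ((N * L ^ (j + 1) : ℕ) : ℤ) ∧
      gaugeAct u U = vary W Z 1 ∧ (∀ w : Site d, u ((((L ^ (j + 1) : ℕ) : ℤ)) • w) = 1) ∧
      (∀ nu : Site d → Matrix n n ℂ, (∀ y, nu y ∈ skewAdjoint (Matrix n n ℂ)) →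
          (∀ (y : Site d) (i : Fin d), nu (y + ((N * L ^ (j + 1) : ℕ) : ℤ) • e i) = nu y) → T nu →
        ∑ y ∈ periodBox (d := d) (N * L ^ (j + 1)), ∑ κ : Fin d, hsR (Z y κ) (gaugeDir W (covLapSite W nu) y κ) = 0) ∧
      (∀ (y : Site d) (μ : Fin d), ‖(((W y μ)⁻¹ * gaugeAct u U y μ : (Matrix n n ℂ)ˣ) : (Matrix n n ℂ)) - 1‖ ≤ r₀ + 5 / 2 * (c₁ * (L : ℝ) ^ (j + 1) * (cR * b₀))) ∧
      (∀ (y : Site d) (μ : Fin d), ‖Z y μ‖ ≤ 2 * (r₀ + 5 / 2 * (c₁ * (L : ℝ) ^ (j + 1) * (cR * b₀)))) ∧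
      (∀ y : Site d, ‖((u y : (Matrix n n ℂ)ˣ) : (Matrix n n ℂ)) - 1‖ ≤ 4 * (c₀ * ((L : ℝ) ^ (j + 1)) ^ 2 * (cR * b₀))) ∧
      (∀ x : Site d, ‖covDiv W Z x‖ ≤ b₀ + 3 * (cR * b₀)) := by
  letI : NormedAlgebra ℚ (Matrix n n ℂ) := NormedAlgebra.restrictScalars ℚ ℝ (Matrix n n ℂ)
  letI : CStarAlgebra (Matrix n n ℂ) := {}
  have hP : 1 ≤ N * L ^ (j + 1) := Nat.mul_pos (by omega) (Nat.pow_pos (by omega))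
  obtain ⟨useq, hseq⟩ := exists_newton_sequence_W_T hd hL hN j T hc₀ hc₁ hcR hWu hWP hG hR hProj hUu hUP hr₀ hb₀ hreg₁ hreg₂ hreg₃ hline
  set M : ℝ := (L : ℝ) ^ (j + 1) with hM
  set rbar : ℝ := r₀ + 5 / 2 * (c₁ * M * (cR * b₀)) with hrbar
  have hrbar4 : rbar ≤ 1 / 4 := hreg₃.trans (by norm_num)
  -- pointwise limits of the gauges
  have hcau : ∀ y : Site d, CauchySeq fun i => ((useq i y : (Matrix n n ℂ)ˣ) : (Matrix n n ℂ)) := fun y =>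
    cauchySeq_of_le_geometric (1 / 2) (2 * (c₀ * M ^ 2 * (cR * b₀))) (by norm_num) fun i => by
      rw [dist_eq_norm, norm_sub_rev]; exact (hseq i).2.2.2.2.1 y
  choose ulim hul using fun y => cauchySeq_tendsto_of_complete (hcau y)
  have hmem : ∀ y : Site d, ulim y ∈ unitary (Matrix n n ℂ) := fun y =>
    isClosed_unitary.mem_of_tendsto (hul y) (Eventually.of_forall fun i => mem_unitaryUnits.mp ((hseq i).1 y))
  let ulimU : Site d → (Matrix n n ℂ)ˣ := fun y => Unitary.toUnits ⟨ulim y, hmem y⟩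
  have hval : ∀ y : Site d, ((ulimU y : (Matrix n n ℂ)ˣ) : (Matrix n n ℂ)) = ulim y := fun y => rfl
  have huU : IsUnitarySite ulimU := fun y => mem_unitaryUnits.mpr (by rw [hval]; exact hmem y)
  have huP : IsPeriodicSite ulimU ((N * L ^ (j + 1) : ℕ) : ℤ) := by
    intro y i
    have hfun : (fun k => ((useq k (y + ((N * L ^ (j + 1) : ℕ) : ℤ) • e i) : (Matrix n n ℂ)ˣ) : (Matrix n n ℂ))) = fun k => ((useq k y : (Matrix n n ℂ)ˣ) : (Matrix n n ℂ)) := by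
      funext k; rw [(hseq k).2.1 y i]
    have h1 := hul (y + ((N * L ^ (j + 1) : ℕ) : ℤ) • e i)
    rw [hfun] at h1
    exact Units.ext (by rw [hval, hval]; exact tendsto_nhds_unique h1 (hul y))
  -- convergence of the relative bond variables and the radius in the limit
  have hV : ∀ (y : Site d) (μ : Fin d),
      Tendsto (fun i => (((W y μ)⁻¹ * gaugeAct (useq i) U y μ : (Matrix n n ℂ)ˣ) : (Matrix n n ℂ))) atTop
        (𝓝 (((W y μ)⁻¹ * gaugeAct ulimU U y μ : (Matrix n n ℂ)ˣ) : (Matrix n n ℂ))) := by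
    intro y μ
    have hform : ∀ (v : Site d → (Matrix n n ℂ)ˣ), IsUnitarySite v →
        (((W y μ)⁻¹ * gaugeAct v U y μ : (Matrix n n ℂ)ˣ) : (Matrix n n ℂ))
          = (((W y μ)⁻¹ : (Matrix n n ℂ)ˣ) : Matrix n n ℂ) * ((v y : (Matrix n n ℂ)) * (U y μ : (Matrix n n ℂ)) * star ((v (y + e μ) : (Matrix n n ℂ)ˣ) : (Matrix n n ℂ))) :=
      fun v hv => by
      simp only [gaugeAct, Units.val_mul, val_inv_eq_star (hv (y + e μ)), mul_assoc]
    rw [hform ulimU huU]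
    simp only [hform (useq _) ((hseq _).1), hval]
    exact (((hul y).mul tendsto_const_nhds).mul (hul (y + e μ)).star).const_mul _
  have hr : ∀ (y : Site d) (μ : Fin d), ‖(((W y μ)⁻¹ * gaugeAct ulimU U y μ : (Matrix n n ℂ)ˣ) : (Matrix n n ℂ)) - 1‖ ≤ rbar := fun y μ =>
    le_of_tendsto ((hV y μ).sub_const 1).norm (Eventually.of_forall fun i => (hseq i).2.2.1 y μ)
  -- the limiting relative potential
  set Z : Site d → Fin d → (Matrix n n ℂ) := fun y μ => mlog (((W y μ)⁻¹ * gaugeAct ulimU U y μ : (Matrix n n ℂ)ˣ) : (Matrix n n ℂ)) with hZ_def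
  have hVu : IsUnitaryCfg (gaugeAct ulimU U) := isUnitaryCfg_gaugeAct_W huU hUu
  have hZs : IsSkewDir Z := isSkewDir_mlog_rel hWu hVu fun y μ => (hr y μ).trans hrbar4
  have hZP : IsPeriodicDir Z ((N * L ^ (j + 1) : ℕ) : ℤ) := isPeriodicDir_mlog_rel hWP (NE3ResidualSliceRep.isPeriodicCfg_gaugeAct huP hUP)
  have hrep : gaugeAct ulimU U = vary W Z 1 := by
    funext y μ
    refine Units.ext ?_
    have h1 : ‖(((W y μ)⁻¹ * gaugeAct ulimU U y μ : (Matrix n n ℂ)ˣ) : (Matrix n n ℂ)) - 1‖ < 1 := (hr y μ).trans_lt (by linarith)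
    have h2 : exp (Z y μ) = (((W y μ)⁻¹ * gaugeAct ulimU U y μ : (Matrix n n ℂ)ˣ) : (Matrix n n ℂ)) := exp_mlog h1
    rw [show (vary W Z 1 y μ : (Matrix n n ℂ)ˣ) = W y μ * expUnit (((1 : ℝ) : ℂ) • Z y μ) from rfl, Units.val_mul, val_expUnit,
      Complex.ofReal_one, one_smul, h2, Units.val_mul, ← mul_assoc, Units.mul_inv, one_mul]
  have hZlim : ∀ (y : Site d) (μ : Fin d), Tendsto (fun i => mlog (((W y μ)⁻¹ * gaugeAct (useq i) U y μ : (Matrix n n ℂ)ˣ) : (Matrix n n ℂ))) atTop (𝓝 (Z y μ)) := by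
    intro y μ
    rw [tendsto_iff_norm_sub_tendsto_zero]
    have h0 : Tendsto (fun i => 4 / 3 * ‖(((W y μ)⁻¹ * gaugeAct (useq i) U y μ : (Matrix n n ℂ)ˣ) : (Matrix n n ℂ))
        - (((W y μ)⁻¹ * gaugeAct ulimU U y μ : (Matrix n n ℂ)ˣ) : (Matrix n n ℂ))‖) atTop (𝓝 0) := by
      have := (tendsto_iff_norm_sub_tendsto_zero.mp (hV y μ)).const_mul (4 / 3)
      simpa using this
    exact squeeze_zero (fun _ => norm_nonneg _)
      (fun i => norm_mlog_sub_mlog_le_four_thirds hrbar4 ((hseq i).2.2.1 y μ) (hr y μ)) h0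
  have hcd : ∀ x : Site d, ‖covDiv W Z x‖ ≤ b₀ + 3 * (cR * b₀) := by
    intro x
    have ht : Tendsto (fun i => covDiv W (fun y μ => mlog (((W y μ)⁻¹ * gaugeAct (useq i) U y μ : (Matrix n n ℂ)ˣ) : (Matrix n n ℂ))) x) atTop
        (𝓝 (covDiv W Z x)) := by
      simp only [covDiv, Ad]
      exact tendsto_finsetSum _ fun μ _ =>
        (((hZlim x μ).const_mul _).mul_const _).sub (hZlim (x - e μ) μ)
    exact le_of_tendsto ht.norm (Eventually.of_forall fun i => (hseq i).2.2.2.1 x)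
  -- (1.38) in the limit
  have hLan : ∀ nu : Site d → Matrix n n ℂ, (∀ y, nu y ∈ skewAdjoint (Matrix n n ℂ)) →
      (∀ (y : Site d) (i : Fin d), nu (y + ((N * L ^ (j + 1) : ℕ) : ℤ) • e i) = nu y) → T nu →
      ∑ y ∈ periodBox (d := d) (N * L ^ (j + 1)), ∑ κ : Fin d, hsR (Z y κ) (gaugeDir W (covLapSite W nu) y κ) = 0 := by
    intro nu hnus hnuP hnu0
    set g : Site d → Fin d → (Matrix n n ℂ) := gaugeDir W (covLapSite W nu) with hg
    -- the pairing of the iterates tends to the pairing of the limit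
    have hpair : ∀ (x : Site d) (κ : Fin d),
        Tendsto (fun i => hsR (mlog (((W x κ)⁻¹ * gaugeAct (useq i) U x κ : (Matrix n n ℂ)ˣ) : (Matrix n n ℂ))) (g x κ)) atTop (𝓝 (hsR (Z x κ) (g x κ))) := by
      intro x κ
      rw [tendsto_iff_norm_sub_tendsto_zero]
      have h0 : Tendsto (fun i => ‖mlog (((W x κ)⁻¹ * gaugeAct (useq i) U x κ : (Matrix n n ℂ)ˣ) : (Matrix n n ℂ)) - Z x κ‖ * ‖g x κ‖) atTop (𝓝 0) := by
        have := (tendsto_iff_norm_sub_tendsto_zero.mp (hZlim x κ)).mul_const ‖g x κ‖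
        simpa using this
      refine squeeze_zero (fun _ => norm_nonneg _) (fun i => ?_) h0
      rw [Real.norm_eq_abs, ← hsR_sub_left]
      exact abs_hsR_le _ _
    have hlim : Tendsto (fun i => ∑ x ∈ periodBox (d := d) (N * L ^ (j + 1)), ∑ κ : Fin d,
        hsR (mlog (((W x κ)⁻¹ * gaugeAct (useq i) U x κ : (Matrix n n ℂ)ˣ) : (Matrix n n ℂ))) (g x κ)) atTop
        (𝓝 (∑ x ∈ periodBox (d := d) (N * L ^ (j + 1)), ∑ κ : Fin d, hsR (Z x κ) (g x κ))) :=
      tendsto_finsetSum _ fun x _ => tendsto_finsetSum _ fun κ _ => hpair x κ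
    -- the pairing of the iterates is `O(2^{−i})`
    set C : ℝ := ∑ x ∈ periodBox (d := d) (N * L ^ (j + 1)), ‖covLapSite W nu x‖ with hC
    have hsmall : ∀ i : ℕ, |∑ x ∈ periodBox (d := d) (N * L ^ (j + 1)), ∑ κ : Fin d,
        hsR (mlog (((W x κ)⁻¹ * gaugeAct (useq i) U x κ : (Matrix n n ℂ)ˣ) : (Matrix n n ℂ))) (g x κ)| ≤ (cR * b₀) * (1 / 2) ^ i * C := by
      intro i
      obtain ⟨lam, hlam, hLan_i, hD_i⟩ := (hseq i).2.2.2.2.2.2.2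
      have hlamP : ∀ (y : Site d) (k : Fin d), lam (y + ((N * L ^ (j + 1) : ℕ) : ℤ) • e k) = lam y := hlam.2.1
      have h0 := hLan_i nu hnus hnuP hnu0
      have hsplit : ∑ x ∈ periodBox (d := d) (N * L ^ (j + 1)), ∑ κ : Fin d, hsR (mlog (((W x κ)⁻¹ * gaugeAct (useq i) U x κ : (Matrix n n ℂ)ˣ) : (Matrix n n ℂ))) (g x κ)
          = -∑ x ∈ periodBox (d := d) (N * L ^ (j + 1)),
              hsR (covLapSite W lam x) (covLapSite W nu x) := by
        rw [← sum_hsR_gaugeDir_gaugeDir_covLapSite hP hWu hWP hlamP hnuP]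
        simp only [hsR_add_left, Finset.sum_add_distrib] at h0
        rw [hg]
        linarith
      rw [hsplit, abs_neg]
      calc |∑ x ∈ periodBox (d := d) (N * L ^ (j + 1)),
              hsR (covLapSite W lam x) (covLapSite W nu x)|
          ≤ ∑ x ∈ periodBox (d := d) (N * L ^ (j + 1)),
              |hsR (covLapSite W lam x) (covLapSite W nu x)| :=
            Finset.abs_sum_le_sum_abs _ _
        _ ≤ ∑ x ∈ periodBox (d := d) (N * L ^ (j + 1)),
              (cR * b₀) * (1 / 2) ^ i * ‖covLapSite W nu x‖ :=
            Finset.sum_le_sum fun x _ => (abs_hsR_le _ _).trans (mul_le_mul_of_nonneg_right (hD_i x) (norm_nonneg _))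
        _ = (cR * b₀) * (1 / 2) ^ i * C := by rw [hC, Finset.mul_sum]
    have hzero : Tendsto (fun i => ∑ x ∈ periodBox (d := d) (N * L ^ (j + 1)), ∑ κ : Fin d,
        hsR (mlog (((W x κ)⁻¹ * gaugeAct (useq i) U x κ : (Matrix n n ℂ)ˣ) : (Matrix n n ℂ))) (g x κ)) atTop (𝓝 0) := by
      have hgeom : Tendsto (fun i : ℕ => (cR * b₀) * (1 / 2 : ℝ) ^ i * C) atTop (𝓝 0) := by
        have := ((tendsto_pow_atTop_nhds_zero_of_lt_one (by norm_num : (0 : ℝ) ≤ 1 / 2) (by norm_num)).const_mul (cR * b₀)).mul_const C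
        simpa using this
      exact squeeze_zero_norm (fun i => by rw [Real.norm_eq_abs]; exact hsmall i) hgeom
    exact tendsto_nhds_unique hlim hzero
  -- NEW: the corners stay pinned in the limit
  have hu0 : ∀ w : Site d, ulimU ((((L ^ (j + 1) : ℕ) : ℤ)) • w) = 1 := by
    intro w
    have hconst : (fun k => ((useq k ((((L ^ (j + 1) : ℕ) : ℤ)) • w) : (Matrix n n ℂ)ˣ) : (Matrix n n ℂ))) = fun _ => (1 : Matrix n n ℂ) := by
      funext k; rw [(hseq k).2.2.2.2.2.2.1 w, Units.val_one]
    have h1 := hul ((((L ^ (j + 1) : ℕ) : ℤ)) • w)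
    rw [hconst] at h1
    exact Units.ext (by rw [hval, Units.val_one]; exact tendsto_nhds_unique h1 tendsto_const_nhds)
  refine ⟨ulimU, Z, huU, huP, hZs, hZP, hrep, hu0, hLan, hr, fun y μ => ?_, fun y => ?_, hcd⟩
  · exact (norm_mlog_le_two_mul ((hr y μ).trans (by linarith))).trans (by linarith [hr y μ])
  · exact le_of_tendsto ((hul y).sub_const 1).norm (Eventually.of_forall fun i => (hseq i).2.2.2.2.2.1 y)




end

end Summit.QuantumFields.BalabanUV.T4Continuum.NE7PinnedLandauRepT
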